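import Summits.Parity.BatemanHorn.Theorems.SoloInformedGeneralPolynomialSplit

/-!
# SoloInformedMoebiusLogPowSplit — the divisor-size split of `∑_{n ≤ x} ∑_{e ∣ F(n)} μ(e) logᵏ e` for ANY polynomial

Solo unit `solo-Parity-informed` (ideation tier, informed mode), session 17; `PLAN.md` §25.2, CLAIMS C79.

For an integer polynomial `F ≠ 0` (`N(n) := |F(n)|`, `ρ_F = polyRootCountMod ![F]`), an exponent `k` and a
level `y`, the Möbius sum `A_k(x) := ∑_{1 ≤ n ≤ x} ∑_{e ∣ N(n)} μ(e) (log e)ᵏ` splits EXACTLY as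

  `A_k(x) = x · M_k(y) + R(x; y) - z(x) · ∑_{e ≤ y} μ(e) logᵏ e + T_k(x; y)`,
  `M_k(y) = ∑_{e ≤ y} μ(e) logᵏ e ρ_F(e)/e`,  `T_k(x; y) = ∑_{n ≤ x} ∑_{e ∣ N(n), e > y} μ(e) logᵏ e`,
  `R(x; y) = ∑_{e ≤ y} μ(e) logᵏ e · (#{n ≤ x : e ∣ F(n)} - x ρ_F(e)/e)`,  `z(x) = #{n ≤ x : F(n) = 0} ≤ #roots(F)`

(`sum_sum_divisors_moebiusLogPow_eq_split`), with `|R(x; y)| ≤ logᵏ y · ∑_{e ≤ y} |μ(e)| ρ_F(e)`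
(`abs_card_filter_dvd_eval_sub_le` of `SoloInformedGeneralPolynomialSplit`).  Consequently
(`sum_sum_divisors_moebiusLogPow_sub_isLittleO`): if `∑_{m ≤ y} |μ(m)| ρ_F(m) ≤ C y logʲ y` (`y ≥ 2`) and
`M_k(y) → A`, then for every cut `y(x) → ∞` with `y logʲ⁺ᵏ y = o(x)`,
`A_k(x) - A·x - T_k(x; y(x)) = o(x)`.  Purely elementary; the number theory enters only through the two
hypotheses (supplied for Bateman–Horn products in `SoloInformedSquarefreeSysRootCountSum` and the log-moment files).
-/

namespace Summit.Parity.BatemanHorn.Theorems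

open Finset Filter ArithmeticFunction Asymptotics Polynomial
open scoped ArithmeticFunction.Moebius Topology
open Literature.NumberTheory.Sieve (polyRootCountMod)

/-! ### Pointwise split at divisor size `y` -/

/-- `∑_{e ∣ N} h(e) = ∑_{e ∣ N, e ≤ y} h(e) + ∑_{e ∣ N, e > y} h(e)`. -/
theorem sum_divisors_eq_filter_le_add_filter_lt (N y : ℕ) (h : ℕ → ℝ) :
    ∑ e ∈ N.divisors, h e = ∑ e ∈ N.divisors with e ≤ y, h e + ∑ e ∈ N.divisors with y < e, h e := by
  rw [← sum_filter_add_sum_filter_not N.divisors (fun e => e ≤ y)]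
  congr 1
  exact sum_congr (filter_congr fun e _ => not_le) fun _ _ => rfl

/-- The small divisors of `N = |F(n)|` as an indicator sum over `[1, y]`, valid also when `F(n) = 0`:
`∑_{e ∣ N, e ≤ y} h(e) = ∑_{e ≤ y, e ∣ F(n)} h(e) - 𝟙[F(n) = 0] ∑_{e ≤ y} h(e)`. -/
theorem sum_divisors_filter_le_eq_indicator (F : ℤ[X]) (n y : ℕ) (h : ℕ → ℝ) :
    ∑ e ∈ ((F.eval (n : ℤ)).natAbs).divisors with e ≤ y, h e
      = ∑ e ∈ (Icc 1 y).filter (fun e : ℕ => (e : ℤ) ∣ F.eval (n : ℤ)), h e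
        - if F.eval (n : ℤ) = 0 then ∑ e ∈ Icc 1 y, h e else 0 := by
  by_cases h0 : F.eval (n : ℤ) = 0
  · rw [if_pos h0, h0]
    simp only [Int.natAbs_zero, Nat.divisors_zero, filter_empty, sum_empty, dvd_zero]
    rw [filter_true_of_mem fun _ _ => trivial, sub_self]
  · rw [if_neg h0, sub_zero, divisors_filter_le_eq_Icc_filter (Int.natAbs_ne_zero.mpr h0) y]
    exact sum_congr (filter_congr fun e _ => Int.natCast_dvd.symm) fun _ _ => rfl

/-- Swapping the sums: `∑_{n ≤ x} ∑_{e ≤ y, e ∣ F(n)} h(e) = ∑_{e ≤ y} h(e) · #{n ≤ x : e ∣ F(n)}`. -/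
theorem sum_sum_filter_dvd_eval_eq (F : ℤ[X]) (x y : ℕ) (h : ℕ → ℝ) :
    ∑ n ∈ Icc 1 x, ∑ e ∈ (Icc 1 y).filter (fun e : ℕ => (e : ℤ) ∣ F.eval (n : ℤ)), h e
      = ∑ e ∈ Icc 1 y, h e * #((Icc 1 x).filter fun n : ℕ => (e : ℤ) ∣ F.eval (n : ℤ)) := by
  simp_rw [sum_filter]
  rw [sum_comm]
  refine sum_congr rfl fun e _ => ?_
  rw [← sum_filter, sum_const, nsmul_eq_mul, mul_comm]

/-- The zeros of `F` among `1 ≤ n ≤ x` are at most the number of distinct integer roots of `F ≠ 0`. -/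
theorem card_filter_eval_eq_zero_le {F : ℤ[X]} (hF : F ≠ 0) (x : ℕ) :
    #((Icc 1 x).filter fun n : ℕ => F.eval (n : ℤ) = 0) ≤ F.roots.toFinset.card := by
  refine card_le_card_of_injOn (fun n : ℕ => (n : ℤ)) (fun n hn => ?_) (fun a _ b _ hab => Nat.cast_injective hab)
  rw [mem_coe, mem_filter] at hn
  rw [mem_coe, Multiset.mem_toFinset, mem_roots hF]
  exact hn.2

/-! ### The exact split of `∑_{n ≤ x} ∑_{e ∣ |F(n)|} μ(e) logᵏ e` -/

/-- **The split identity.**  For every `F ∈ ℤ[X]`, `k`, `x`, `y`: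
`∑_{n ≤ x} ∑_{e ∣ |F(n)|} μ(e) logᵏ e = x · M_k(y) + R(x; y) - z(x) · ∑_{e ≤ y} μ(e) logᵏ e + T_k(x; y)`. -/
theorem sum_sum_divisors_moebiusLogPow_eq_split (F : ℤ[X]) (k x y : ℕ) :
    ∑ n ∈ Icc 1 x, ∑ e ∈ ((F.eval (n : ℤ)).natAbs).divisors, (μ e : ℝ) * Real.log e ^ k
      = (x : ℝ) * ∑ e ∈ Icc 1 y, (μ e : ℝ) * Real.log e ^ k * (polyRootCountMod ![F] e : ℝ) / e
        + ∑ e ∈ Icc 1 y, (μ e : ℝ) * Real.log e ^ k *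
            ((#((Icc 1 x).filter fun n : ℕ => (e : ℤ) ∣ F.eval (n : ℤ)) : ℝ)
              - (x : ℝ) * (polyRootCountMod ![F] e : ℝ) / e)
        - (#((Icc 1 x).filter fun n : ℕ => F.eval (n : ℤ) = 0) : ℝ) *
            ∑ e ∈ Icc 1 y, (μ e : ℝ) * Real.log e ^ k
        + ∑ n ∈ Icc 1 x, ∑ e ∈ ((F.eval (n : ℤ)).natAbs).divisors with y < e,
            (μ e : ℝ) * Real.log e ^ k := by
  have hpt : ∀ n ∈ Icc 1 x, ∑ e ∈ ((F.eval (n : ℤ)).natAbs).divisors, (μ e : ℝ) * Real.log e ^ k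
      = (∑ e ∈ (Icc 1 y).filter (fun e : ℕ => (e : ℤ) ∣ F.eval (n : ℤ)), (μ e : ℝ) * Real.log e ^ k
          - if F.eval (n : ℤ) = 0 then ∑ e ∈ Icc 1 y, (μ e : ℝ) * Real.log e ^ k else 0)
        + ∑ e ∈ ((F.eval (n : ℤ)).natAbs).divisors with y < e, (μ e : ℝ) * Real.log e ^ k := by
    intro n _
    rw [sum_divisors_eq_filter_le_add_filter_lt _ y, sum_divisors_filter_le_eq_indicator]
  rw [sum_congr rfl hpt, sum_add_distrib, sum_sub_distrib, sum_sum_filter_dvd_eval_eq, ← sum_filter,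
    sum_const, nsmul_eq_mul]
  have hmain : ∑ e ∈ Icc 1 y, (μ e : ℝ) * Real.log e ^ k *
      (#((Icc 1 x).filter fun n : ℕ => (e : ℤ) ∣ F.eval (n : ℤ)) : ℝ)
      = (x : ℝ) * ∑ e ∈ Icc 1 y, (μ e : ℝ) * Real.log e ^ k * (polyRootCountMod ![F] e : ℝ) / e
        + ∑ e ∈ Icc 1 y, (μ e : ℝ) * Real.log e ^ k *
            ((#((Icc 1 x).filter fun n : ℕ => (e : ℤ) ∣ F.eval (n : ℤ)) : ℝ)
              - (x : ℝ) * (polyRootCountMod ![F] e : ℝ) / e) := by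
    rw [mul_sum, ← sum_add_distrib]
    exact sum_congr rfl fun e _ => by ring
  rw [hmain]

/-! ### Bounds for the two remainders -/

/-- `|R(x; y)| ≤ logᵏ y · ∑_{e ≤ y} |μ(e)| ρ_F(e)`. -/
theorem abs_moebiusLogPow_rem_le (F : ℤ[X]) (k x y : ℕ) :
    |∑ e ∈ Icc 1 y, (μ e : ℝ) * Real.log e ^ k *
        ((#((Icc 1 x).filter fun n : ℕ => (e : ℤ) ∣ F.eval (n : ℤ)) : ℝ)
          - (x : ℝ) * (polyRootCountMod ![F] e : ℝ) / e)|
      ≤ Real.log y ^ k * ∑ e ∈ Icc 1 y, |(μ e : ℝ)| * (polyRootCountMod ![F] e : ℝ) := by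
  refine (abs_sum_le_sum_abs _ _).trans ?_
  rw [mul_sum]
  refine sum_le_sum fun e he => ?_
  obtain ⟨he1, hey⟩ := mem_Icc.mp he
  have hlog0 : 0 ≤ Real.log (e : ℝ) := Real.log_natCast_nonneg e
  have hlogy : Real.log (e : ℝ) ≤ Real.log y := Real.log_le_log (by exact_mod_cast he1) (by exact_mod_cast hey)
  have hrem := abs_card_filter_dvd_eval_sub_le F (by omega : 0 < e) x
  rw [abs_mul, abs_mul, abs_pow, abs_of_nonneg hlog0]
  calc |(μ e : ℝ)| * Real.log e ^ k * |((#((Icc 1 x).filter fun n : ℕ => (e : ℤ) ∣ F.eval (n : ℤ)) : ℝ)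
          - (x : ℝ) * (polyRootCountMod ![F] e : ℝ) / e)|
      ≤ |(μ e : ℝ)| * Real.log y ^ k * (polyRootCountMod ![F] e : ℝ) :=
        mul_le_mul (mul_le_mul_of_nonneg_left (pow_le_pow_left₀ hlog0 hlogy k) (abs_nonneg _)) hrem
          (abs_nonneg _) (by positivity)
    _ = Real.log y ^ k * (|(μ e : ℝ)| * (polyRootCountMod ![F] e : ℝ)) := by ring

/-- `|∑_{e ≤ y} μ(e) logᵏ e| ≤ y logᵏ y`. -/
theorem abs_sum_moebiusLogPow_le (k y : ℕ) :
    |∑ e ∈ Icc 1 y, (μ e : ℝ) * Real.log e ^ k| ≤ y * Real.log y ^ k := by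
  refine (abs_sum_le_sum_abs _ _).trans ?_
  have hle : ∀ e ∈ Icc 1 y, |(μ e : ℝ) * Real.log e ^ k| ≤ Real.log y ^ k := by
    intro e he
    obtain ⟨he1, hey⟩ := mem_Icc.mp he
    have hlog0 : 0 ≤ Real.log (e : ℝ) := Real.log_natCast_nonneg e
    have hlogy : Real.log (e : ℝ) ≤ Real.log y :=
      Real.log_le_log (by exact_mod_cast he1) (by exact_mod_cast hey)
    have hμ : |(μ e : ℝ)| ≤ 1 := by exact_mod_cast abs_moebius_le_one
    rw [abs_mul, abs_pow, abs_of_nonneg hlog0]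
    calc |(μ e : ℝ)| * Real.log e ^ k ≤ 1 * Real.log y ^ k :=
          mul_le_mul hμ (pow_le_pow_left₀ hlog0 hlogy k) (by positivity) zero_le_one
      _ = Real.log y ^ k := one_mul _
  refine (sum_le_sum hle).trans ?_
  rw [sum_const, Nat.card_Icc, Nat.add_sub_cancel, nsmul_eq_mul]

/-! ### The asymptotic form under the two analytic inputs -/

/-- **`∑_{n ≤ x} ∑_{e ∣ |F(n)|} μ(e) logᵏ e = A·x + T_k(x; y(x)) + o(x)`** whenever
`∑_{m ≤ y} |μ(m)| ρ_F(m) ≤ C y logʲ y` (`y ≥ 2`), `M_k(y) = ∑_{e ≤ y} μ(e) logᵏ e ρ_F(e)/e → A`, and the cut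
satisfies `y(x) → ∞`, `y logʲ⁺ᵏ y = o(x)`. -/
theorem sum_sum_divisors_moebiusLogPow_sub_isLittleO {F : ℤ[X]} (hF : F ≠ 0) {k j : ℕ} {C : ℝ}
    (hC : ∀ y : ℝ, 2 ≤ y →
      ∑ m ∈ Icc 1 ⌊y⌋₊, |(μ m : ℝ)| * (polyRootCountMod ![F] m : ℝ) ≤ C * y * Real.log y ^ j)
    {A : ℝ} (hA : Tendsto (fun y : ℕ => ∑ e ∈ Icc 1 y,
      (μ e : ℝ) * Real.log e ^ k * (polyRootCountMod ![F] e : ℝ) / e) atTop (𝓝 A))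
    {y : ℕ → ℕ} (hy : Tendsto y atTop atTop)
    (hy' : (fun x : ℕ => (y x : ℝ) * Real.log (y x) ^ (j + k)) =o[atTop] fun x : ℕ => (x : ℝ)) :
    (fun x : ℕ => ∑ n ∈ Icc 1 x, ∑ e ∈ ((F.eval (n : ℤ)).natAbs).divisors, (μ e : ℝ) * Real.log e ^ k
        - A * x
        - ∑ n ∈ Icc 1 x, ∑ e ∈ ((F.eval (n : ℤ)).natAbs).divisors with y x < e,
            (μ e : ℝ) * Real.log e ^ k)
      =o[atTop] fun x : ℕ => (x : ℝ) := by
  set Z : ℕ := F.roots.toFinset.card with hZ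
  have hC0 : 0 ≤ C := by
    have h := hC 2 le_rfl
    have h0 : 0 ≤ ∑ m ∈ Icc 1 ⌊(2 : ℝ)⌋₊, |(μ m : ℝ)| * (polyRootCountMod ![F] m : ℝ) :=
      sum_nonneg fun m _ => mul_nonneg (abs_nonneg _) (Nat.cast_nonneg _)
    have hl : 0 < Real.log 2 := Real.log_pos (by norm_num)
    nlinarith [pow_pos hl j]
  rw [isLittleO_iff]
  intro c hc
  -- the three pieces: `x (M_k(y) - A)`, `R`, `z · ∑ μ logᵏ`
  have h1 : ∀ᶠ x : ℕ in atTop, |∑ e ∈ Icc 1 (y x),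
      (μ e : ℝ) * Real.log e ^ k * (polyRootCountMod ![F] e : ℝ) / e - A| ≤ c / 3 := by
    have hev := hy.eventually (Metric.tendsto_nhds.mp hA (c / 3) (by positivity))
    filter_upwards [hev] with x hx
    rw [Real.dist_eq] at hx
    exact hx.le
  have h2 : ∀ᶠ x : ℕ in atTop, (C + Z) * ((y x : ℝ) * Real.log (y x) ^ (j + k)) ≤ c / 3 * x := by
    have h := hy'.bound (show (0 : ℝ) < c / 3 / (C + Z + 1) by positivity)
    filter_upwards [h] with x hx
    rw [Real.norm_eq_abs, Real.norm_eq_abs, Nat.abs_cast,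
      abs_of_nonneg (mul_nonneg (Nat.cast_nonneg _) (pow_nonneg (Real.log_natCast_nonneg _) _))] at hx
    have hCZ : 0 ≤ C + Z := by positivity
    calc (C + Z) * ((y x : ℝ) * Real.log (y x) ^ (j + k))
        ≤ (C + Z) * (c / 3 / (C + Z + 1) * x) := mul_le_mul_of_nonneg_left hx hCZ
      _ = (C + Z) / (C + Z + 1) * (c / 3 * x) := by ring
      _ ≤ 1 * (c / 3 * x) := by
          refine mul_le_mul_of_nonneg_right ?_ (by positivity)
          rw [div_le_one (by positivity)]
          linarith
      _ = c / 3 * x := one_mul _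
  have h3 : ∀ᶠ x : ℕ in atTop, 3 ≤ y x := hy.eventually_ge_atTop 3
  filter_upwards [h1, h2, h3, eventually_ge_atTop 1] with x hx1 hx2 hy3 hx
  have hx0 : (0 : ℝ) ≤ x := by positivity
  have hy2 : (2 : ℝ) ≤ y x := by exact_mod_cast (by omega : 2 ≤ y x)
  have hlogy1 : 1 ≤ Real.log (y x) := by
    rw [← Real.log_exp 1]
    refine Real.log_le_log (Real.exp_pos 1) ?_
    have := Real.exp_one_lt_d9
    have h3' : (3 : ℝ) ≤ y x := by exact_mod_cast hy3
    linarith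
  have hlogy0 : 0 ≤ Real.log (y x) := by linarith
  rw [sum_sum_divisors_moebiusLogPow_eq_split F k x (y x)]
  set M := ∑ e ∈ Icc 1 (y x), (μ e : ℝ) * Real.log e ^ k * (polyRootCountMod ![F] e : ℝ) / e with hM
  set R := ∑ e ∈ Icc 1 (y x), (μ e : ℝ) * Real.log e ^ k *
      ((#((Icc 1 x).filter fun n : ℕ => (e : ℤ) ∣ F.eval (n : ℤ)) : ℝ)
        - (x : ℝ) * (polyRootCountMod ![F] e : ℝ) / e) with hR
  set zx : ℝ := (#((Icc 1 x).filter fun n : ℕ => F.eval (n : ℤ) = 0) : ℝ) with hzx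
  set Sμ := ∑ e ∈ Icc 1 (y x), (μ e : ℝ) * Real.log e ^ k with hSμ
  set T := ∑ n ∈ Icc 1 x, ∑ e ∈ ((F.eval (n : ℤ)).natAbs).divisors with y x < e,
      (μ e : ℝ) * Real.log e ^ k with hT
  have hRle : |R| ≤ C * ((y x : ℝ) * Real.log (y x) ^ (j + k)) := by
    refine (abs_moebiusLogPow_rem_le F k x (y x)).trans ?_
    have h := hC (y x) hy2
    rw [Nat.floor_natCast] at h
    calc Real.log (y x) ^ k * ∑ e ∈ Icc 1 (y x), |(μ e : ℝ)| * (polyRootCountMod ![F] e : ℝ)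
        ≤ Real.log (y x) ^ k * (C * (y x) * Real.log (y x) ^ j) :=
          mul_le_mul_of_nonneg_left h (pow_nonneg hlogy0 k)
      _ = C * ((y x : ℝ) * Real.log (y x) ^ (j + k)) := by rw [pow_add]; ring
  have hzx0 : 0 ≤ zx := Nat.cast_nonneg _
  have hzxZ : zx ≤ Z := by rw [hzx, hZ]; exact_mod_cast card_filter_eval_eq_zero_le hF x
  have hZle : |zx * Sμ| ≤ (Z : ℝ) * ((y x : ℝ) * Real.log (y x) ^ (j + k)) := by
    rw [abs_mul, abs_of_nonneg hzx0]
    refine mul_le_mul hzxZ ((abs_sum_moebiusLogPow_le k (y x)).trans ?_) (abs_nonneg _) (Nat.cast_nonneg _)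
    rw [pow_add]
    calc (y x : ℝ) * Real.log (y x) ^ k = (y x : ℝ) * (1 * Real.log (y x) ^ k) := by ring
      _ ≤ (y x : ℝ) * (Real.log (y x) ^ j * Real.log (y x) ^ k) :=
          mul_le_mul_of_nonneg_left (mul_le_mul_of_nonneg_right (one_le_pow₀ hlogy1) (pow_nonneg hlogy0 k))
            (Nat.cast_nonneg _)
  have hmain : |(x : ℝ) * M - A * x| ≤ c / 3 * x := by
    have e : (x : ℝ) * M - A * x = x * (M - A) := by ring
    rw [e, abs_mul, abs_of_nonneg hx0, mul_comm]
    exact mul_le_mul_of_nonneg_right hx1 hx0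
  rw [Real.norm_eq_abs, Real.norm_eq_abs, abs_of_nonneg hx0]
  have e : (x : ℝ) * M + R - zx * Sμ + T - A * x - T = ((x : ℝ) * M - A * x) + R - zx * Sμ := by ring
  rw [e]
  calc |((x : ℝ) * M - A * x) + R - zx * Sμ|
      ≤ |(x : ℝ) * M - A * x| + |R| + |zx * Sμ| := by
        exact (abs_sub _ _).trans (add_le_add (abs_add_le _ _) le_rfl)
    _ ≤ c / 3 * x + C * ((y x : ℝ) * Real.log (y x) ^ (j + k)) + Z * ((y x : ℝ) * Real.log (y x) ^ (j + k)) :=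
        add_le_add (add_le_add hmain hRle) hZle
    _ = c / 3 * x + (C + Z) * ((y x : ℝ) * Real.log (y x) ^ (j + k)) := by ring
    _ ≤ c / 3 * x + c / 3 * x := add_le_add le_rfl hx2
    _ ≤ c * x := by nlinarith

/-! ### The standard cut `y = ⌊x^{1-ε}⌋` is admissible for every log-power -/

/-- `⌊x^{1-ε}⌋ · log^A ⌊x^{1-ε}⌋ = o(x)` for `0 < ε < 1` and every `A`. -/
theorem rpowCut_mul_log_pow_isLittleO {ε : ℝ} (hε : 0 < ε) (hε1 : ε < 1) (A : ℕ) :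
    (fun x : ℕ => ((⌊(x : ℝ) ^ (1 - ε)⌋₊ : ℕ) : ℝ) * Real.log ((⌊(x : ℝ) ^ (1 - ε)⌋₊ : ℕ) : ℝ) ^ A)
      =o[atTop] fun x : ℕ => (x : ℝ) := by
  have hlog : (fun t : ℝ => Real.log t ^ (A : ℝ)) =o[atTop] fun t : ℝ => t ^ ε :=
    isLittleO_log_rpow_rpow_atTop (A : ℝ) hε
  have hlogN : (fun x : ℕ => Real.log (x : ℝ) ^ (A : ℝ)) =o[atTop] fun x : ℕ => (x : ℝ) ^ ε :=
    hlog.comp_tendsto tendsto_natCast_atTop_atTop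
  rw [isLittleO_iff]
  intro c hc
  filter_upwards [hlogN.bound hc, eventually_ge_atTop 1] with x hx hx1
  have hX1 : (1 : ℝ) ≤ x := by exact_mod_cast hx1
  have hX0 : (0 : ℝ) < x := by linarith
  have hl0 : 0 ≤ Real.log (x : ℝ) := Real.log_nonneg hX1
  rw [Real.norm_eq_abs, Real.norm_eq_abs, Real.rpow_natCast, abs_of_nonneg (pow_nonneg hl0 A),
    abs_of_pos (Real.rpow_pos_of_pos hX0 _)] at hx
  set Y : ℕ := ⌊(x : ℝ) ^ (1 - ε)⌋₊ with hY
  have hYle : (Y : ℝ) ≤ (x : ℝ) ^ (1 - ε) := Nat.floor_le (by positivity)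
  have hYx : (Y : ℝ) ≤ x := by
    refine hYle.trans ?_
    calc (x : ℝ) ^ (1 - ε) ≤ (x : ℝ) ^ (1 : ℝ) := Real.rpow_le_rpow_of_exponent_le hX1 (by linarith)
      _ = x := Real.rpow_one _
  have hlogY0 : 0 ≤ Real.log (Y : ℝ) := Real.log_natCast_nonneg Y
  have hlogY : Real.log (Y : ℝ) ≤ Real.log x := by
    rcases Nat.eq_zero_or_pos Y with hY0 | hY0
    · rw [hY0, Nat.cast_zero, Real.log_zero]; exact hl0
    · exact Real.log_le_log (by exact_mod_cast hY0) hYx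
  rw [Real.norm_eq_abs, Real.norm_eq_abs, abs_of_nonneg (mul_nonneg (Nat.cast_nonneg Y) (pow_nonneg hlogY0 A)),
    abs_of_pos hX0]
  calc (Y : ℝ) * Real.log (Y : ℝ) ^ A ≤ (x : ℝ) ^ (1 - ε) * Real.log x ^ A :=
        mul_le_mul hYle (pow_le_pow_left₀ hlogY0 hlogY A) (pow_nonneg hlogY0 A) (by positivity)
    _ ≤ (x : ℝ) ^ (1 - ε) * (c * (x : ℝ) ^ ε) := mul_le_mul_of_nonneg_left hx (by positivity)
    _ = c * x := by
        rw [mul_comm, mul_assoc, ← Real.rpow_add hX0]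
        norm_num

/-- `⌊x^{1-ε}⌋ → ∞`. -/
theorem tendsto_rpowCut_atTop {ε : ℝ} (hε1 : ε < 1) :
    Tendsto (fun x : ℕ => ⌊(x : ℝ) ^ (1 - ε)⌋₊) atTop atTop := by
  refine tendsto_nat_floor_atTop.comp ?_
  exact (tendsto_rpow_atTop (by linarith)).comp tendsto_natCast_atTop_atTop

end Summit.Parity.BatemanHorn.Theorems
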